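import Mathlib
import HarnessLib

/-!
# Venture HSemireg — the operator `Q(κ) = Σ_i u_i B_i` and the first moment of the degree-two trace law

HONEST FRAMING. Lean leaf for the computation cell `pub-hsemireg` (target seat t-5 gen 19; file of record
`run/shared/lean/pub/pub-hsemireg/target-g6/W3-QLAW-t5g19.md`, continuing `W3-YLAW-t5g18.md` and th-3's
`theory/TH3-SIGMA-ORBIT-PROOF.md` §5.13). Setting as in `FibreTestW3DefectPairing`: in the minimal twisted-complex
model of a «reduced-point complex» on a smooth threefold germ a W-class has even components `B₀, B₁, B₂`, a second
class has even components `C₀, C₁, C₂` and odd potentials `W₀, W₁, W₂` tied to the odd gluing operators `u₀, u₁, u₂`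
by the Killing relations (E1) `u_l W_j + W_j u_l = ε_{jli} C_i`, and a class is closed (E2) when
`Σ_l (u_l B_l - B_l u_l) = 0`. The degree-two object of the cell's «(1+z)-hierarchy» is the cross product
`Z₀ = (B × C)₀ = B₁ C₂ - B₂ C₁` (cyclically), whose level traces are conjectured to be divisible by `(1+z)³`
(law (LT₂) of W3-YLAW §8.15; at four levels: proportional to `(1,3,3,1)`).

THIS FILE kernel-checks the finite identities behind t-5 g19's reduction of the FIRST MOMENT of (LT₂) to a tangency
statement for the single operator `Q(κ) := u₀ B₀ + u₁ B₁ + u₂ B₂` (the volume coefficient of `δ·κ` in th-3's dga):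
1. `crossComponent_eq_sum_anticomm` — (E2) for `B` and the three Killing relations of the second class AT THE
   POTENTIAL `W₀` give `Z₀ = Σ_i {u_i, B_i W₀}` (any ring);
2. `supertrace_level_anticomm_eq_supertrace_mul` — for a parity operator `σ` and a level operator `η`
   (`σ x = -x σ`, `η x - x η = x`): `str(η {x,Y}) = str(x Y)`, and
   `supertrace_levelSq_anticomm` — `str(η² {x,Y}) = 2 str(η x Y) - str(x Y)`;
3. `supertrace_level_crossComponent_eq_supertrace_Q_mul` — hence `str(η Z₀) = str(Q W₀)` with
   `Q = u₀B₀ + u₁B₁ + u₂B₂`: the first moment of the level-trace polynomial of `(B × C)₀` is the supertrace pairing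
   of `Q(κ)` with the potential `W₀`;
4. `supertrace_mul_eq_zero_of_tangent_of_conormal` — if `Q = θ u₀ - u₀ θ` is TANGENT at `u₀` (an infinitesimal
   conjugation) and `W₀` is CONORMAL at `u₀` (`u₀ W₀ + W₀ u₀ = 0`, which is the diagonal Killing relation), then
   `str(Q W₀) = 0`; so `supertrace_level_crossComponent_eq_zero_of_tangent`: `str(η Z₀) = 0`;
5. `Q_eq_comm_of_defectFree` and `supertrace_level_crossComponent_eq_zero_of_defectFree` — THEOREM: if the first
   class is defect-free at the base direction (e.g. on a FLAT pencil) and the orbit-lemma gauge elements exist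
   (generic base direction), then `Q = [ξ₀B₀ + ξ₁B₁ + ξ₂B₂, u₀]` is tangent and `str(η Z₀) = 0` for EVERY second
   class: the first moment of (LT₂) holds on the defect-free stratum (new; th-3's flat-stratum theorem gives only
   supertraces of words in the components).
Item 4's tangency hypothesis is the cell's machine law (QT) «`Q(κ) ∈ T_{u(s)}O` for generic `s`» AT FOUR LEVELS
(W3-QLAW §0(C): no exception in ≈10⁵ exact class tests on four-level pencils; it FAILS on some five- and seven-level
pencils, where the trace law (LT₂) nevertheless holds, W3-QLAW §0(H); NOT a theorem; not a formal consequence of the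
known tangency letters, W3-QLAW §3), taken at the base direction `u₀` (generic after a frame change). Nothing here
proves (QT), (LT₂) or (W³); no object is constructed; nothing here bears on HC, HC_CM or HC_AV.
-/

namespace Summit.Ventures.HSemireg

open LinearMap

/-- **Cross product as a sum of anticommutators** (t-5 g19, W3-QLAW §1.1; any ring). If the first class is closed,
`Σ_l [u_l, B_l] = 0` (E2), and the second class satisfies the three Killing relations at its potential `W₀` —
`{u₀,W₀} = 0`, `{u₁,W₀} = C₂`, `{u₂,W₀} = -C₁` — then `(B × C)₀ = B₁C₂ - B₂C₁ = Σ_i {u_i, B_i W₀}`.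
Proof: `Σ_i {u_i, B_iW₀} = (Σ_i [u_i,B_i]) W₀ + Σ_i B_i {u_i,W₀}`. The components `1, 2` follow by the cyclic
relabelling `0 → 1 → 2 → 0`. [folklore] -/
theorem crossComponent_eq_sum_anticomm {R : Type*} [Ring R]
    (u₀ u₁ u₂ B₀ B₁ B₂ W₀ C₁ C₂ : R)
    (hdiv : (u₀ * B₀ - B₀ * u₀) + (u₁ * B₁ - B₁ * u₁) + (u₂ * B₂ - B₂ * u₂) = 0)
    (h00 : u₀ * W₀ + W₀ * u₀ = 0) (h10 : u₁ * W₀ + W₀ * u₁ = C₂) (h20 : u₂ * W₀ + W₀ * u₂ = -C₁) :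
    B₁ * C₂ - B₂ * C₁
      = (u₀ * (B₀ * W₀) + (B₀ * W₀) * u₀) + (u₁ * (B₁ * W₀) + (B₁ * W₀) * u₁)
        + (u₂ * (B₂ * W₀) + (B₂ * W₀) * u₂) := by
  have key : (u₀ * (B₀ * W₀) + (B₀ * W₀) * u₀) + (u₁ * (B₁ * W₀) + (B₁ * W₀) * u₁)
        + (u₂ * (B₂ * W₀) + (B₂ * W₀) * u₂)
      = ((u₀ * B₀ - B₀ * u₀) + (u₁ * B₁ - B₁ * u₁) + (u₂ * B₂ - B₂ * u₂)) * W₀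
        + (B₀ * (u₀ * W₀ + W₀ * u₀) + B₁ * (u₁ * W₀ + W₀ * u₁) + B₂ * (u₂ * W₀ + W₀ * u₂)) := by
    noncomm_ring
  rw [key, hdiv, h00, h10, h20]
  noncomm_ring

variable {F : Type*} [Field F]
variable {U : Type*} [AddCommGroup U] [Module F U]

/-- **First level moment of an anticommutator** (t-5 g19, W3-QLAW §1.1). For a parity operator `σ` and a level
operator `η` with `σ x = -(x σ)` (x odd) and `η x - x η = x` (x raises the level by one; no relation between `σ` and `η` is needed), and any `Y`:
`trace (σ η (x Y + Y x)) = trace (σ x Y)`, i.e. `str(h·{x,Y}) = str(x·Y)`. Proof: cyclicity moves the `x` of the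
second term to the front, the anticommutation produces a sign, and `x η = η x - x`. [folklore] -/
theorem supertrace_level_anticomm_eq_supertrace_mul (σ η x Y : Module.End F U)
    (hσx : σ * x = -(x * σ)) (hηx : η * x - x * η = x) :
    LinearMap.trace F U (σ * (η * (x * Y + Y * x))) = LinearMap.trace F U (σ * (x * Y)) := by
  have hxη : x * η = η * x - x := by
    have h2 : η * x - x * η - x = 0 := by rw [hηx]; exact sub_self x
    have h3 : x * η = η * x - x - (η * x - x * η - x) := by noncomm_ring
    rw [h2, sub_zero] at h3
    exact h3
  have cyc : LinearMap.trace F U (σ * η * Y * x) = LinearMap.trace F U (x * (σ * η * Y)) := by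
    rw [LinearMap.trace_mul_comm]
  have op : x * (σ * η * Y) = -(σ * η * x * Y) + σ * (x * Y) := by
    calc x * (σ * η * Y) = (x * σ) * η * Y := by noncomm_ring
      _ = (-(σ * x)) * η * Y := by rw [hσx]; noncomm_ring
      _ = -(σ * (x * η) * Y) := by noncomm_ring
      _ = -(σ * (η * x - x) * Y) := by rw [hxη]
      _ = -(σ * η * x * Y) + σ * (x * Y) := by noncomm_ring
  have expand : σ * (η * (x * Y + Y * x)) = σ * η * x * Y + σ * η * Y * x := by noncomm_ring
  rw [expand, map_add, cyc, op, map_add, map_neg]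
  abel

/-- **Second level moment of an anticommutator** (t-5 g19, W3-QLAW §1.1). Under the same hypotheses:
`trace (σ η η (x Y + Y x)) = 2 · trace (σ η x Y) - trace (σ x Y)`, i.e. `str(h²{x,Y}) = 2 str(h x Y) - str(x Y)`
(from `x η² = (η-1)² x`). Together with the previous lemma: the level traces `a_p = tr(xY | M_{p+1})` of an
anticommutator `{x,Y}` satisfy `str({x,Y}) = 0`, `str(h{x,Y}) = -Σ(-1)^p a_p`, `str(h²{x,Y}) = -Σ(-1)^p (2p+1) a_p`.
[folklore] -/
theorem supertrace_levelSq_anticomm (σ η x Y : Module.End F U)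
    (hσx : σ * x = -(x * σ)) (hηx : η * x - x * η = x) :
    LinearMap.trace F U (σ * (η * η * (x * Y + Y * x)))
      = 2 • LinearMap.trace F U (σ * (η * (x * Y))) - LinearMap.trace F U (σ * (x * Y)) := by
  have hxη : x * η = η * x - x := by
    have h2 : η * x - x * η - x = 0 := by rw [hηx]; exact sub_self x
    have h3 : x * η = η * x - x - (η * x - x * η - x) := by noncomm_ring
    rw [h2, sub_zero] at h3
    exact h3
  have cyc : LinearMap.trace F U (σ * η * η * Y * x) = LinearMap.trace F U (x * (σ * η * η * Y)) := by
    rw [LinearMap.trace_mul_comm]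
  have op : x * (σ * η * η * Y)
      = -(σ * η * η * x * Y) + 2 • (σ * (η * (x * Y))) - σ * (x * Y) := by
    calc x * (σ * η * η * Y) = (x * σ) * η * η * Y := by noncomm_ring
      _ = (-(σ * x)) * η * η * Y := by rw [hσx]; noncomm_ring
      _ = -(σ * (x * η) * η * Y) := by noncomm_ring
      _ = -(σ * (η * x - x) * η * Y) := by rw [hxη]
      _ = -(σ * η * (x * η) * Y) + σ * (x * η) * Y := by noncomm_ring
      _ = -(σ * η * (η * x - x) * Y) + σ * (η * x - x) * Y := by rw [hxη]
      _ = -(σ * η * η * x * Y) + 2 • (σ * (η * (x * Y))) - σ * (x * Y) := by noncomm_ring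
  have expand : σ * (η * η * (x * Y + Y * x)) = σ * η * η * x * Y + σ * η * η * Y * x := by noncomm_ring
  have e2 : σ * (η * (x * Y)) = σ * η * x * Y := by noncomm_ring
  rw [expand, map_add, cyc, op, map_sub, map_add, map_neg, map_nsmul, e2]
  abel

/-- **The first moment of `(B × C)₀` is the pairing of `Q(κ)` with the potential** (t-5 g19, W3-QLAW §1.1).
Data in the endomorphism ring of the total space (any number of levels): parity operator `σ` and level operator `η`
with `σ u_i = -u_i σ`, `η u_i - u_i η = u_i` (i = 0,1,2); a closed first class `B` ((E2)); a second class
with Killing relations at `W₀`. Then `str(η·(B₁C₂ - B₂C₁)) = str(Q·W₀)` with `Q := u₀B₀ + u₁B₁ + u₂B₂`.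
Consequently the law (LT₂)_{j=1} «`str(h·(B×C)_l) = 0`» is EQUIVALENT to «`Q(κ)` is supertrace-orthogonal to the
potentials of every W-class», which follows from the tangency law (QT) (next two lemmas). [folklore] -/
theorem supertrace_level_crossComponent_eq_supertrace_Q_mul
    (σ η u₀ u₁ u₂ B₀ B₁ B₂ W₀ C₁ C₂ : Module.End F U)
    (hσ0 : σ * u₀ = -(u₀ * σ)) (hσ1 : σ * u₁ = -(u₁ * σ)) (hσ2 : σ * u₂ = -(u₂ * σ))
    (hη0 : η * u₀ - u₀ * η = u₀) (hη1 : η * u₁ - u₁ * η = u₁) (hη2 : η * u₂ - u₂ * η = u₂)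
    (hdiv : (u₀ * B₀ - B₀ * u₀) + (u₁ * B₁ - B₁ * u₁) + (u₂ * B₂ - B₂ * u₂) = 0)
    (h00 : u₀ * W₀ + W₀ * u₀ = 0) (h10 : u₁ * W₀ + W₀ * u₁ = C₂) (h20 : u₂ * W₀ + W₀ * u₂ = -C₁) :
    LinearMap.trace F U (σ * (η * (B₁ * C₂ - B₂ * C₁)))
      = LinearMap.trace F U (σ * ((u₀ * B₀ + u₁ * B₁ + u₂ * B₂) * W₀)) := by
  rw [crossComponent_eq_sum_anticomm u₀ u₁ u₂ B₀ B₁ B₂ W₀ C₁ C₂ hdiv h00 h10 h20]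
  have expand : σ * (η * ((u₀ * (B₀ * W₀) + (B₀ * W₀) * u₀) + (u₁ * (B₁ * W₀) + (B₁ * W₀) * u₁)
        + (u₂ * (B₂ * W₀) + (B₂ * W₀) * u₂)))
      = σ * (η * (u₀ * (B₀ * W₀) + (B₀ * W₀) * u₀)) + σ * (η * (u₁ * (B₁ * W₀) + (B₁ * W₀) * u₁))
        + σ * (η * (u₂ * (B₂ * W₀) + (B₂ * W₀) * u₂)) := by
    noncomm_ring
  rw [expand, map_add, map_add,
    supertrace_level_anticomm_eq_supertrace_mul σ η u₀ (B₀ * W₀) hσ0 hη0,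
    supertrace_level_anticomm_eq_supertrace_mul σ η u₁ (B₁ * W₀) hσ1 hη1,
    supertrace_level_anticomm_eq_supertrace_mul σ η u₂ (B₂ * W₀) hσ2 hη2,
    ← map_add, ← map_add]
  congr 1
  noncomm_ring

/-- **Tangent times conormal is supertraceless** (the one-line mechanism of th-3's orbit lemma, TH3-SIGMA-ORBIT-PROOF
§3; here for an arbitrary tangent vector). If `Q = θ x - x θ` is an infinitesimal conjugate of the odd operator `x`
(a tangent vector to its orbit) and `W` is conormal at `x` (`x W + W x = 0`), then `str(Q W) = 0` for any parity
operator `σ` with `σ x = -x σ`. [folklore] -/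
theorem supertrace_mul_eq_zero_of_tangent_of_conormal (σ x θ Q W : Module.End F U)
    (hσx : σ * x = -(x * σ)) (hQ : Q = θ * x - x * θ) (hW : x * W + W * x = 0) :
    LinearMap.trace F U (σ * (Q * W)) = 0 := by
  have hWx : W * x = -(x * W) := eq_neg_of_add_eq_zero_right hW
  have op1 : σ * x * (θ * W) = -(x * (σ * θ * W)) := by
    calc σ * x * (θ * W) = (σ * x) * (θ * W) := by noncomm_ring
      _ = (-(x * σ)) * (θ * W) := by rw [hσx]
      _ = -(x * (σ * θ * W)) := by noncomm_ring
  have op2 : σ * θ * W * x = -(σ * θ * x * W) := by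
    calc σ * θ * W * x = σ * θ * (W * x) := by noncomm_ring
      _ = σ * θ * (-(x * W)) := by rw [hWx]
      _ = -(σ * θ * x * W) := by noncomm_ring
  have t2 : LinearMap.trace F U (σ * x * (θ * W)) = LinearMap.trace F U (σ * θ * x * W) := by
    rw [op1, map_neg, LinearMap.trace_mul_comm, op2, map_neg, neg_neg]
  have expand : σ * (Q * W) = σ * θ * x * W - σ * x * (θ * W) := by rw [hQ]; noncomm_ring
  rw [expand, map_sub, t2, sub_self]

/-- **(QT) at the base direction ⇒ the first moment of (LT₂)** (t-5 g19, W3-QLAW §0(B)). With the data of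
`supertrace_level_crossComponent_eq_supertrace_Q_mul`, if moreover `Q = u₀B₀ + u₁B₁ + u₂B₂` is tangent to the
orbit at `u₀` — `Q = θ u₀ - u₀ θ` for some level-preserving `θ`, which is the four-level machine law (QT) of W3-QLAW
taken at the (generic) base direction — then `str(η·(B×C)₀) = 0`, because the potential `W₀` is conormal at `u₀` by the diagonal
Killing relation. The hypothesis (QT) is NOT proved here or anywhere. [folklore] -/
theorem supertrace_level_crossComponent_eq_zero_of_tangent
    (σ η u₀ u₁ u₂ B₀ B₁ B₂ W₀ C₁ C₂ θ : Module.End F U)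
    (hσ0 : σ * u₀ = -(u₀ * σ)) (hσ1 : σ * u₁ = -(u₁ * σ)) (hσ2 : σ * u₂ = -(u₂ * σ))
    (hη0 : η * u₀ - u₀ * η = u₀) (hη1 : η * u₁ - u₁ * η = u₁) (hη2 : η * u₂ - u₂ * η = u₂)
    (hdiv : (u₀ * B₀ - B₀ * u₀) + (u₁ * B₁ - B₁ * u₁) + (u₂ * B₂ - B₂ * u₂) = 0)
    (h00 : u₀ * W₀ + W₀ * u₀ = 0) (h10 : u₁ * W₀ + W₀ * u₁ = C₂) (h20 : u₂ * W₀ + W₀ * u₂ = -C₁)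
    (hQT : u₀ * B₀ + u₁ * B₁ + u₂ * B₂ = θ * u₀ - u₀ * θ) :
    LinearMap.trace F U (σ * (η * (B₁ * C₂ - B₂ * C₁))) = 0 := by
  rw [supertrace_level_crossComponent_eq_supertrace_Q_mul σ η u₀ u₁ u₂ B₀ B₁ B₂ W₀ C₁ C₂
        hσ0 hσ1 hσ2 hη0 hη1 hη2 hdiv h00 h10 h20]
  exact supertrace_mul_eq_zero_of_tangent_of_conormal σ u₀ θ (u₀ * B₀ + u₁ * B₁ + u₂ * B₂) W₀ hσ0 hQT h00

/-- **Q is tangent on the defect-free stratum** (t-5 g19, W3-QLAW §1.4; any ring). If the components of the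
class commute with the base direction (`u₀ B_i = B_i u₀`, i.e. the three defects at `u₀` vanish — on a FLAT pencil
every (E1)∧(E2) class is defect-free by th-3's defect formula, TH3-SIGMA-ORBIT-PROOF §7.2) and the other two pencil
directions are infinitesimal conjugates of `u₀` (`u_i = ξ_i u₀ - u₀ ξ_i`, the ORBIT LEMMA at a generic base direction,
TH3 §2 — taken as a hypothesis here, as in `FibreTestSigmaOrbitStep`; for `i = 0` the level operator serves), then
`Q = u₀B₀ + u₁B₁ + u₂B₂ = θ u₀ - u₀ θ` with the explicit `θ = ξ₀B₀ + ξ₁B₁ + ξ₂B₂`. [folklore] -/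
theorem Q_eq_comm_of_defectFree {R : Type*} [Ring R]
    (u₀ u₁ u₂ B₀ B₁ B₂ ξ₀ ξ₁ ξ₂ : R)
    (ht0 : u₀ = ξ₀ * u₀ - u₀ * ξ₀) (ht1 : u₁ = ξ₁ * u₀ - u₀ * ξ₁) (ht2 : u₂ = ξ₂ * u₀ - u₀ * ξ₂)
    (hd0 : u₀ * B₀ = B₀ * u₀) (hd1 : u₀ * B₁ = B₁ * u₀) (hd2 : u₀ * B₂ = B₂ * u₀) :
    u₀ * B₀ + u₁ * B₁ + u₂ * B₂
      = (ξ₀ * B₀ + ξ₁ * B₁ + ξ₂ * B₂) * u₀ - u₀ * (ξ₀ * B₀ + ξ₁ * B₁ + ξ₂ * B₂) := by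
  have e0 : u₀ * B₀ = ξ₀ * B₀ * u₀ - u₀ * ξ₀ * B₀ := by
    calc u₀ * B₀ = (ξ₀ * u₀ - u₀ * ξ₀) * B₀ := by rw [← ht0]
      _ = ξ₀ * (u₀ * B₀) - u₀ * ξ₀ * B₀ := by noncomm_ring
      _ = ξ₀ * (B₀ * u₀) - u₀ * ξ₀ * B₀ := by rw [hd0]
      _ = ξ₀ * B₀ * u₀ - u₀ * ξ₀ * B₀ := by noncomm_ring
  have e1 : u₁ * B₁ = ξ₁ * B₁ * u₀ - u₀ * ξ₁ * B₁ := by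
    calc u₁ * B₁ = (ξ₁ * u₀ - u₀ * ξ₁) * B₁ := by rw [← ht1]
      _ = ξ₁ * (u₀ * B₁) - u₀ * ξ₁ * B₁ := by noncomm_ring
      _ = ξ₁ * (B₁ * u₀) - u₀ * ξ₁ * B₁ := by rw [hd1]
      _ = ξ₁ * B₁ * u₀ - u₀ * ξ₁ * B₁ := by noncomm_ring
  have e2 : u₂ * B₂ = ξ₂ * B₂ * u₀ - u₀ * ξ₂ * B₂ := by
    calc u₂ * B₂ = (ξ₂ * u₀ - u₀ * ξ₂) * B₂ := by rw [← ht2]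
      _ = ξ₂ * (u₀ * B₂) - u₀ * ξ₂ * B₂ := by noncomm_ring
      _ = ξ₂ * (B₂ * u₀) - u₀ * ξ₂ * B₂ := by rw [hd2]
      _ = ξ₂ * B₂ * u₀ - u₀ * ξ₂ * B₂ := by noncomm_ring
  rw [e0, e1, e2]
  noncomm_ring

/-- **THEOREM: the first moment of (LT₂) on the defect-free stratum** (t-5 g19, W3-QLAW §5(b)). Data in the
endomorphism ring of the total space (any number of levels): parity `σ` and level operator `η` as above; a first class
`B` that is closed ((E2)) and DEFECT-FREE at the base direction `u₀` (e.g. any (E1)∧(E2) class of a flat pencil); a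
second class `C` with potentials satisfying the Killing relations at `W₀`; and the orbit-lemma gauge elements `ξ_i`
(`u_i = [ξ_i, u₀]`, available whenever `u₀` is a generic direction of the pencil, TH3 §2). Then
`str(η · (B×C)₀) = 0`: the level-trace polynomial of the cross product is divisible by `(1+z)²`, for EVERY second
class `C` — one order more than th-3's flat-stratum theorem (which gives `str` of words in the components only) and
with only the FIRST class required to be defect-free. The general (curved) case is the open law (QT). [folklore] -/
theorem supertrace_level_crossComponent_eq_zero_of_defectFree
    (σ η u₀ u₁ u₂ B₀ B₁ B₂ W₀ C₁ C₂ ξ₀ ξ₁ ξ₂ : Module.End F U)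
    (hσ0 : σ * u₀ = -(u₀ * σ)) (hσ1 : σ * u₁ = -(u₁ * σ)) (hσ2 : σ * u₂ = -(u₂ * σ))
    (hη0 : η * u₀ - u₀ * η = u₀) (hη1 : η * u₁ - u₁ * η = u₁) (hη2 : η * u₂ - u₂ * η = u₂)
    (hdiv : (u₀ * B₀ - B₀ * u₀) + (u₁ * B₁ - B₁ * u₁) + (u₂ * B₂ - B₂ * u₂) = 0)
    (h00 : u₀ * W₀ + W₀ * u₀ = 0) (h10 : u₁ * W₀ + W₀ * u₁ = C₂) (h20 : u₂ * W₀ + W₀ * u₂ = -C₁)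
    (ht0 : u₀ = ξ₀ * u₀ - u₀ * ξ₀) (ht1 : u₁ = ξ₁ * u₀ - u₀ * ξ₁) (ht2 : u₂ = ξ₂ * u₀ - u₀ * ξ₂)
    (hd0 : u₀ * B₀ = B₀ * u₀) (hd1 : u₀ * B₁ = B₁ * u₀) (hd2 : u₀ * B₂ = B₂ * u₀) :
    LinearMap.trace F U (σ * (η * (B₁ * C₂ - B₂ * C₁))) = 0 :=
  supertrace_level_crossComponent_eq_zero_of_tangent σ η u₀ u₁ u₂ B₀ B₁ B₂ W₀ C₁ C₂ (ξ₀ * B₀ + ξ₁ * B₁ + ξ₂ * B₂)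
    hσ0 hσ1 hσ2 hη0 hη1 hη2 hdiv h00 h10 h20 (Q_eq_comm_of_defectFree u₀ u₁ u₂ B₀ B₁ B₂ ξ₀ ξ₁ ξ₂ ht0 ht1 ht2 hd0 hd1 hd2)

end Summit.Ventures.HSemireg
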